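import Summits.ResolutionOfSingularities.ResolutionOfSingularities.Theorems.HilbertSamuelEliminationSigmaMaxModificationsCorridor3SigmaStrataDepth
import Summits.ResolutionOfSingularities.ResolutionOfSingularities.Theorems.HilbertSamuelEliminationSigmaMaxModificationsCorridor3SigmaIsoBoundaryTransition
import HarnessLib

/-!
# [OURS · L1 W4.2] σ-LAYER — `Corridor3SigmaStrataDepthE`: the PER-STEP DEPTH LAWS for a boundary-READING admissible strategy
# (`StrategyE`, `StepProjectionσE`) — E-copy of the sibling `…Corridor3SigmaStrataDepth` (same seat, same session)

Crux chain w42 (`SigmaMaxModifications`, stmt-ResolutionOfSingularities-18506; conjunct `SigmaMaxModificationsCorridor3`,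
stmt-ResolutionOfSingularities-19249); cell E3 «births control» of ELIMINATION LINE v2 (res-L1-w42-plan-1); typer res-type-053 (gen 11).
OURS (cell res-hironaka, slot W4.2); NOT statements of H. Hironaka's manuscript [Hironaka2017] nor of [CossartJannsenSaito2020]; AI-proved,
weaker than expert review. Sorry-free PROOF file: no definition, no named fact, no binder, no characteristic hypothesis; `--supports
stmt-ResolutionOfSingularities-19249 --as helper` (counted 0).

WHAT. res-L1-type-o1's `StepProjectionσE σ N ν s s' f` («`f` is the blow-down of the boundary-threaded σ-step», `…SigmaIsoBoundaryDefs`;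
API `canonicalNearStepσE` / `exists_stepProjectionσE` / `base_pt` / `pt_mem_hsStratum` / `unique` = res-type-012's
`…SigmaIsoBoundaryTransition`, p530850, imported) gets `isClosed_pt`, `exists_step_and_isBlowup`, `StrategyE.IsFunctional.forall_step`
and the three depth laws of `…WLadderStrataDepthBlowup` at one σE-step
of a strategy ADMISSIBLE ON THE BOUNDARY-THREADED MARKED SCOPE (o1's `IsAdmissibleStrategyOnE (StrategyE.ReachableState p σ 3 ν E₀)`; kit
res-type-012's `IsMaximalOrigin.of_reachesσE`, `IsAdmissibleStrategyOnE.step_specE`): a depth jump is carried by the fibre (any σ); a step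
whose centre MISSES `x_n` carries no depth jump (any σ); every allowed centre through `x_n` a SURFACE there ⇒ no depth jump; every allowed
centre through `x_n` POSITIVE-DIMENSIONAL there ⇒ a depth jump puts a whole irreducible component `cl z'` of `f⁻¹(x_n)` through `x_{n+1}`
inside `Z'`. This is the form a MENU-DISCIPLINED boundary-reading strategy (o1 `…SigmaMenuStrategy`, res-type-067 `…SigmaMenu*` /
`SigmaBirthDictionary3`, res-type-040's `StrategyE` lineage rows) calls at its steps; centre clauses in the «for every step σ allows from
the state of `s`» shape (no functionality needed).
-/

noncomputable section

set_option linter.dupNamespace false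

open CategoryTheory AlgebraicGeometry TopologicalSpace Topology Order IsLocalRing
open Literature.AlgebraicGeometry.Resolution Literature.RingTheory.HilbertSamuel
open Summit.ResolutionOfSingularities.ResolutionOfSingularities.Theorems.CampaignW42
open Summit.ResolutionOfSingularities.ResolutionOfSingularities.Theorems.SigmaMaxModificationsCorridor3.Moving
open Scheme.IdealSheafData

namespace Summit.ResolutionOfSingularities.ResolutionOfSingularities.Theorems.SigmaMaxModificationsCorridor3.Sigma

universe u

variable {p : ℕ} {N : ℕ} {ν : ℕ → ℕ}

/-! ## The depth laws for a boundary-READING strategy (`StrategyE`, `StepProjectionσE`) -/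

section Threaded

variable {σ : StrategyE.{u}} {E₀ : ∀ (X : Scheme.{u}), X → Boundary X}

/-- The marked point of the target of a σE-step projection is closed. [folklore] -/
theorem StepProjectionσE.isClosed_pt {s s' : MarkedStageE.{u}} {f : s'.W ⟶ s.W} (hf : StepProjectionσE σ N ν s s' f) :
    IsClosed ({s'.pt} : Set s'.W) :=
  hf.canonicalNearStepσE.isClosed_pt

/-- **A σE-step projection IS a blow-up of `X_n` in a centre σ allows from the boundary-threaded state of `s`.** [folklore] -/
theorem StepProjectionσE.exists_step_and_isBlowup {s s' : MarkedStageE.{u}} {f : s'.W ⟶ s.W} (hf : StepProjectionσE σ N ν s s' f) :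
    ∃ (C : s.W.IdealSheafData) (P' : Option (Pending (blowup C))), σ.step s.W s.ln N ν s.L s.P s.E C P' ∧ IsBlowup f C := by
  obtain ⟨C, P', h, x', hcs, -, -, -, e, hfe⟩ := hf
  refine ⟨C, P', hcs, ?_⟩
  rw [hfe]
  exact (blowup.isBlowup C).iso_comp (eqToIso (congrArg MarkedStage.W (congrArg MarkedStageE.toMarkedStage e)))

/-- For a FUNCTIONAL boundary-reading σ a property of one allowed centre is a property of every allowed centre. [folklore] -/
theorem StrategyE.IsFunctional.forall_step (hσ : σ.IsFunctional N ν) {s : MarkedStageE.{u}} {C : s.W.IdealSheafData}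
    {P' : Option (Pending (blowup C))} (hcs : σ.step s.W s.ln N ν s.L s.P s.E C P') {Q : s.W.IdealSheafData → Prop} (hQ : Q C) :
    ∀ (C' : s.W.IdealSheafData) (P'' : Option (Pending (blowup C'))), σ.step s.W s.ln N ν s.L s.P s.E C' P'' → Q C' := by
  intro C' P'' h'
  obtain rfl : C = C' := (hσ s.W s.ln s.L s.P s.E).1 C C' P' P'' hcs h'
  exact hQ

/-- **σE: EITHER OVER THE CENTRE, OR NO DEEPER** — along a σE-step projection, for every irreducible closed `Z' ∋ x_{n+1}`: either
`cl f(Z')` lies in the support of the step's centre, or `codim_{Z'}(x_{n+1}) ≤ codim_{cl f(Z')}(x_n)`. Any boundary-reading σ, any level.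
[cite: Matsumura1987, Thm. 15.5] -/
theorem StepProjectionσE.exists_centre_or_coheight_le {s s' : MarkedStageE.{u}} {f : s'.W ⟶ s.W} (hf : StepProjectionσE σ N ν s s' f)
    {Z' : Set s'.W} (hirr : IsIrreducible Z') (hcl : IsClosed Z') (hx' : s'.pt ∈ Z') :
    (∃ (C : s.W.IdealSheafData) (P' : Option (Pending (blowup C))), σ.step s.W s.ln N ν s.L s.P s.E C P' ∧ IsBlowup f C ∧
        closure (f.base '' Z') ⊆ (C.support : Set s.W)) ∨
      coheight (⟨s'.pt, hx'⟩ : ↥Z') ≤ coheight (⟨s.pt, subset_closure ⟨s'.pt, hx', hf.base_pt⟩⟩ : ↥(closure (f.base '' Z'))) := by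
  haveI := s.ln
  haveI := s'.ln
  obtain ⟨C, P', hcs, hbl⟩ := hf.exists_step_and_isBlowup
  by_cases hB : closure (f.base '' Z') ⊆ (C.support : Set s.W)
  · exact Or.inl ⟨C, P', hcs, hbl, hB⟩
  · refine Or.inr ?_
    have key := hbl.coheight_le_coheight_closure_image hirr hcl hx' hB
    have e : (⟨f.base s'.pt, subset_closure ⟨s'.pt, hx', rfl⟩⟩ : ↥(closure (f.base '' Z'))) =
        ⟨s.pt, subset_closure ⟨s'.pt, hx', hf.base_pt⟩⟩ := Subtype.ext hf.base_pt
    rw [e] at key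
    exact key

/-- **σE: A DEPTH JUMP LIES OVER THE CENTRE** (conjunct (b) of `StrataDepthDiscipline` at one σE-step): with `x_n` closed, an irreducible
closed `Z' ∋ x_{n+1}` with a sandwich at `x_{n+1}` and none at `x_n` in `cl f(Z')` has `cl f(Z')` inside the support of the step's centre.
[cite: Matsumura1987, Thm. 15.5] -/
theorem StepProjectionσE.exists_centre_of_hasSandwichAt {s s' : MarkedStageE.{u}} {f : s'.W ⟶ s.W} (hf : StepProjectionσE σ N ν s s' f)
    (hsc : IsClosed ({s.pt} : Set s.W)) {Z' : Set s'.W} (hirr : IsIrreducible Z') (hcl : IsClosed Z') (hx' : s'.pt ∈ Z')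
    (hup : HasSandwichAt s'.toMarkedStage Z') (hdown : ¬ HasSandwichAt s.toMarkedStage (closure (f.base '' Z'))) :
    ∃ (C : s.W.IdealSheafData) (P' : Option (Pending (blowup C))), σ.step s.W s.ln N ν s.L s.P s.E C P' ∧ IsBlowup f C ∧
      closure (f.base '' Z') ⊆ (C.support : Set s.W) := by
  haveI := s.ln
  haveI := s'.ln
  rcases hf.exists_centre_or_coheight_le hirr hcl hx' with h | hle
  · exact h
  · exfalso
    have hirrB : IsIrreducible (closure (f.base '' Z')) := (hirr.image f.base f.continuous.continuousOn).closure
    have h2 : 2 ≤ coheight (⟨s'.pt, hx'⟩ : ↥Z') := (two_le_coheight_iff_exists_sandwich hirr hcl hx' hf.isClosed_pt).mpr hup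
    exact hdown ((two_le_coheight_iff_exists_sandwich hirrB isClosed_closure
      (subset_closure ⟨s'.pt, hx', hf.base_pt⟩) hsc).mp (h2.trans hle))

/-- **σE: a depth jump through the chain point is carried by the fibre** (any boundary-reading σ, any level; `x_n` closed).
[cite: Matsumura1987, Thm. 15.1] -/
theorem StepProjectionσE.exists_fibre_generization_of_hasSandwichAt {s s' : MarkedStageE.{u}} {f : s'.W ⟶ s.W}
    (hf : StepProjectionσE σ N ν s s' f) (hsc : IsClosed ({s.pt} : Set s.W)) {Z' : Set s'.W} (hirr : IsIrreducible Z')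
    (hcl : IsClosed Z') (hx' : s'.pt ∈ Z') (hup : HasSandwichAt s'.toMarkedStage Z')
    (hdown : ¬ HasSandwichAt s.toMarkedStage (closure (f.base '' Z'))) :
    ∃ z' ∈ Z', z' ⤳ s'.pt ∧ z' ≠ s'.pt ∧ f.base z' = s.pt := by
  haveI := s.ln
  haveI := s'.ln
  have hpt : f.base s'.pt = s.pt := hf.base_pt
  have hyc : IsClosed ({f.base s'.pt} : Set s.W) := by rw [hpt]; exact hsc
  have hdown' : ¬ ∃ B : Set s.W, IsIrreducible B ∧ IsClosed B ∧ f.base s'.pt ∈ B ∧ B ⊆ closure (f.base '' Z') ∧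
      B ≠ {f.base s'.pt} ∧ B ≠ closure (f.base '' Z') := by rw [hpt]; exact hdown
  obtain ⟨z', hz', hzx, hne, hfz⟩ := exists_fibre_generization_of_sandwich f hf.isClosed_pt hyc hirr hcl hx' hup hdown'
  exact ⟨z', hz', hzx, hne, hfz.trans hpt⟩

/-- **σE: a step whose centre misses `x_n` carries no depth jump** (one-point fibre). Any boundary-reading σ, any level.
[cite: Matsumura1987, Thm. 15.1] -/
theorem StepProjectionσE.hasSandwichAt_closure_image_of_not_mem {s s' : MarkedStageE.{u}} {f : s'.W ⟶ s.W}
    (hf : StepProjectionσE σ N ν s s' f)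
    (hC : ∀ (C : s.W.IdealSheafData) (P' : Option (Pending (blowup C))), σ.step s.W s.ln N ν s.L s.P s.E C P' →
      s.pt ∉ (C.support : Set s.W))
    {Z' : Set s'.W} (hirr : IsIrreducible Z') (hcl : IsClosed Z') (hup : HasSandwichAt s'.toMarkedStage Z') :
    HasSandwichAt s.toMarkedStage (closure (f.base '' Z')) := by
  obtain ⟨C, P', hcs, hbl⟩ := hf.exists_step_and_isBlowup
  exact hasSandwichAt_closure_image_of_isBlowup_of_not_mem (s := s.toMarkedStage) (s' := s'.toMarkedStage) hbl hf.base_pt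
    hf.isClosed_pt (hC C P' hcs) hirr hcl hup

/-- **σE: EVERY ALLOWED CENTRE THROUGH `x_n` A SURFACE THERE ⇒ NO DEPTH JUMP** — σ admissible on the boundary-threaded marked scope
(`IsAdmissibleStrategyOnE (StrategyE.ReachableState p σ 3 ν E₀)`), `s` σ-reached from a maximal origin started with `E₀` (level `3`).
[cite: CossartJannsenSaito2020, Thm. 3.10 (proof, p. 46)] [cite: Matsumura1987, Thm. 15.1] -/
theorem StepProjectionσE.hasSandwichAt_closure_image_of_surface_centre
    (hadm : IsAdmissibleStrategyOnE (StrategyE.ReachableState p σ 3 ν E₀) 3 ν σ)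
    {X : Scheme.{u}} [IsLocallyNoetherian X] {x : X} (hX : IsMaximalOrigin p 3 ν X x) {s s' : MarkedStageE.{u}}
    (hreach : ReachesσE σ 3 ν (MarkedStageE.init X x (E₀ X x)) s) {f : s'.W ⟶ s.W} (hf : StepProjectionσE σ 3 ν s s' f)
    (hC : ∀ (C : s.W.IdealSheafData) (P' : Option (Pending (blowup C))), σ.step s.W s.ln 3 ν s.L s.P s.E C P' →
      ∀ hx : s.pt ∈ (C.support : Set s.W), 2 ≤ coheight (⟨s.pt, hx⟩ : ↥(C.support : Set s.W)))
    {Z' : Set s'.W} (hirr : IsIrreducible Z') (hcl : IsClosed Z') (hx' : s'.pt ∈ Z') (hup : HasSandwichAt s'.toMarkedStage Z') :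
    HasSandwichAt s.toMarkedStage (closure (f.base '' Z')) := by
  haveI := s.ln
  haveI := s'.ln
  obtain ⟨C, P', hcs, hbl⟩ := hf.exists_step_and_isBlowup
  have hpt : f.base s'.pt = s.pt := hf.base_pt
  by_cases hxC : s.pt ∈ (C.support : Set s.W)
  · have hO : IsMaximalOrigin p 3 ν s.W s.pt := hX.of_reachesσE hadm hreach
    have hperm : IdealSheafData.IsPermissible C := (hadm.step_specE (inScopeMσE_of_reachesσE hX hreach) hcs).1
    have hyC : f.base s'.pt ∈ (C.support : Set s.W) := by rw [hpt]; exact hxC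
    have hsurf : 2 ≤ coheight (⟨f.base s'.pt, hyC⟩ : ↥(C.support : Set s.W)) := by
      have e : (⟨f.base s'.pt, hyC⟩ : ↥(C.support : Set s.W)) = ⟨s.pt, hxC⟩ := Subtype.ext hpt
      rw [e]; exact hC C P' hcs hxC
    have hyc : IsClosed ({f.base s'.pt} : Set s.W) := by rw [hpt]; exact hO.isClosed
    obtain ⟨B, hBirr, hBcl, hxB, hBZ, hBx, hBne⟩ := IsBlowup.sandwich_image_of_two_le_coheight_support hbl hO.dim_le
      hf.isClosed_pt hyc ((IdealSheafData.isPermissible_iff C).mp hperm _ hyC) hyC hsurf hirr hcl hx' hup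
    rw [hpt] at hxB hBx
    exact ⟨B, hBirr, hBcl, hxB, hBZ, hBx, hBne⟩
  · exact hasSandwichAt_closure_image_of_isBlowup_of_not_mem (s := s.toMarkedStage) (s' := s'.toMarkedStage) hbl hpt
      hf.isClosed_pt hxC hirr hcl hup

/-- **σE: EVERY ALLOWED CENTRE THROUGH `x_n` POSITIVE-DIMENSIONAL THERE: A DEPTH JUMP SWALLOWS A FIBRE COMPONENT** (`cl z' ⊆ Z'`, `z'`
maximal in `f⁻¹(x_n)`, `z' ⤳ x_{n+1}`, `z' ≠ x_{n+1}`) — σ admissible on the boundary-threaded marked scope, `s` σ-reached from a maximal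
origin started with `E₀` (level `3`). [cite: CossartJannsenSaito2020, Thm. 3.10 (proof, p. 46)] [cite: Matsumura1987, Thm. 15.1] -/
theorem StepProjectionσE.exists_fibre_component_subset_of_hasSandwichAt
    (hadm : IsAdmissibleStrategyOnE (StrategyE.ReachableState p σ 3 ν E₀) 3 ν σ)
    {X : Scheme.{u}} [IsLocallyNoetherian X] {x : X} (hX : IsMaximalOrigin p 3 ν X x) {s s' : MarkedStageE.{u}}
    (hreach : ReachesσE σ 3 ν (MarkedStageE.init X x (E₀ X x)) s) {f : s'.W ⟶ s.W} (hf : StepProjectionσE σ 3 ν s s' f)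
    (hC : ∀ (C : s.W.IdealSheafData) (P' : Option (Pending (blowup C))), σ.step s.W s.ln 3 ν s.L s.P s.E C P' →
      ∀ hx : s.pt ∈ (C.support : Set s.W), 1 ≤ coheight (⟨s.pt, hx⟩ : ↥(C.support : Set s.W)))
    {Z' : Set s'.W} (hirr : IsIrreducible Z') (hcl : IsClosed Z') (hx' : s'.pt ∈ Z') (hup : HasSandwichAt s'.toMarkedStage Z')
    (hdown : ¬ HasSandwichAt s.toMarkedStage (closure (f.base '' Z'))) :
    ∃ z' : s'.W, f.base z' = s.pt ∧ z' ⤳ s'.pt ∧ z' ≠ s'.pt ∧ (∀ w : s'.W, f.base w = s.pt → w ⤳ z' → w = z') ∧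
      closure ({z'} : Set s'.W) ⊆ Z' := by
  haveI := s.ln
  haveI := s'.ln
  obtain ⟨C, P', hcs, hbl⟩ := hf.exists_step_and_isBlowup
  have hpt : f.base s'.pt = s.pt := hf.base_pt
  by_cases hxC : s.pt ∈ (C.support : Set s.W)
  · have hO : IsMaximalOrigin p 3 ν s.W s.pt := hX.of_reachesσE hadm hreach
    have hperm : IdealSheafData.IsPermissible C := (hadm.step_specE (inScopeMσE_of_reachesσE hX hreach) hcs).1
    have hyC : f.base s'.pt ∈ (C.support : Set s.W) := by rw [hpt]; exact hxC
    have hpos : 1 ≤ coheight (⟨f.base s'.pt, hyC⟩ : ↥(C.support : Set s.W)) := by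
      have e : (⟨f.base s'.pt, hyC⟩ : ↥(C.support : Set s.W)) = ⟨s.pt, hxC⟩ := Subtype.ext hpt
      rw [e]; exact hC C P' hcs hxC
    have hyc : IsClosed ({f.base s'.pt} : Set s.W) := by rw [hpt]; exact hO.isClosed
    have hdown' : ¬ ∃ B : Set s.W, IsIrreducible B ∧ IsClosed B ∧ f.base s'.pt ∈ B ∧ B ⊆ closure (f.base '' Z') ∧
        B ≠ {f.base s'.pt} ∧ B ≠ closure (f.base '' Z') := by rw [hpt]; exact hdown
    obtain ⟨z', hfz, hzx, hne, hmax, hclz⟩ := IsBlowup.exists_fibre_component_subset_of_sandwich hbl hO.dim_le hf.isClosed_pt hyc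
      ((IdealSheafData.isPermissible_iff C).mp hperm _ hyC) hyC hpos hirr hcl hx' hup hdown'
    refine ⟨z', hfz.trans hpt, hzx, hne, fun w hw hwz => hmax w (hw.trans hpt.symm) hwz, hclz⟩
  · exact absurd (hasSandwichAt_closure_image_of_isBlowup_of_not_mem (s := s.toMarkedStage) (s' := s'.toMarkedStage) hbl hpt
      hf.isClosed_pt hxC hirr hcl hup) hdown

end Threaded

end Summit.ResolutionOfSingularities.ResolutionOfSingularities.Theorems.SigmaMaxModificationsCorridor3.Sigma

end
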